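import Literature.NumberTheory.Rogawski1990.TamagawaSingularMembersFinTFCovol   -- ★ p844690: the letter — κ-BLOCK-TF text, (Q-fin) guard, frame currency
import Literature.NumberTheory.Automorphic.OrbitalMeasureQuotientOfAgree        -- ★ p848196: `OrbitalMeasureFamily.IsQuotientOf.apply_eq_of_isQuotientOf` (two Weil families of the same data agree on the guard)
import Literature.NumberTheory.Rogawski1990.IsQuotientOfHaarRatio             -- ★ p847850: `stableOrbitalIntegralRel_congr_measure` (stable class sums read the members on the stable class only)
import HarnessLib

/-!
# κ-BLOCK TRANSPORT BETWEEN TWO WEIL FAMILIES OF THE SAME PARTNERS — organ O6 «κ-TRANSPORT» of the LH5 pay-down of S1′-fin-TF-COVOL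
(Rogawski (1990), §4.1 (4.1.1) p. 39, §4.3 (4.3.1) pp. 43–44, §5.4 p. 72; Deitmar–Echterhoff (2014), Thm. 1.5.3)

Topic `NumberTheory/Rogawski1990`; namespace `Literature.NumberTheory.Rogawski1990`.  THEOREMS ONLY (no definition, no instance, no notation, no named fact, no `sorry`).  Cell
`pub/hodgecm-mathlib`, crux H413 (`stmt-HodgeConjecture-24833`), line LH5 (closer stub `stub_S1finTFCovol` = ★ `TamagawaSingularMembersFinTFCovolClosed`), pay-down skeleton v1
`F0/P3c/LH5/LH5-plan/g0/StubS1finTFCovol.paydown.skeleton.v1.lean` 9456d302f4282333 (LH5-plan (g0)), ORGAN O6 `stub_kappaBlock_transport` (IN-HOUSE) — dealt to LH5-p01 (g0) 02:30:26Z.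
HONEST LABEL: HC_CM is proved only modulo the printed citations until rung 0 closes; this file is bookkeeping (no printed citation is proved): two Weil-quotient families of
`νG_v` by the SAME partners agree on the guarded classes, so the κ-letters pass from one to the other.

THE MATHEMATICS.  (Q-fin) = ★ `OrbitalMeasureFamily.IsQuotientOf P_v (νG v) (tGs v)` pins a family ON THE `P_v`-CLASSES: `m c = dνG_v ∕ d(tGs v (out c))` (★ `quotientMeasure`; the
`IsHaarMeasure` ∕ `IsInvInvariant` witnesses are propositions, so two such families are EQUAL at every guarded class — ★ `IsQuotientOf.apply_eq_of_isQuotientOf`, p848196).  The local stable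
orbital integral `Φ^st((γ₀)_v, f) = Σ_{[x] ⊂ 𝒪_st((γ₀)_v)} Φ([x], f)` (★ `localStableOrbitalIntegral` = `stableOrbitalIntegralRel (IsStablyConj …)`, (4.1.1)) only reads classes `[x]`
with `(γ₀)_v ↔ x` (★ `Corresponds` IS `IsStablyConj` for `H = H′`, `corresponds_self_iff`), all guarded by `γ₀` itself when `γ₀` is non-regular — which the κ-block's eigenvalue
binder `charpoly γ₀ = (X − e₁)²(X − e₂)` gives (★ `not_isRegularElt_of_charpoly_eq_sq_mul` is in a sibling not imported here; re-derived in two lines).  Hence (κ-loc) transports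
with the same constants `c_v`; (κ-arch) and (κ-sign) do not read the finite members.

* `stableOrbitalIntegralRel_eq_of_isQuotientOf` — (★ `IsQuotientOf.apply_eq_of_isQuotientOf` p848196 + ★ `stableOrbitalIntegralRel_congr_measure` p847850) their stable class sums agree at every `γ` whose stable class is guarded.
* **`kappaBlockTF_of_isQuotientOf_of_isQuotientOf`** — ORGAN O6 VERBATIM (the skeleton's `stub_kappaBlock_transport` text, frame + ∀-prefix token for token): κ-BLOCK-TF for `mGs₀`
  ⟹ κ-BLOCK-TF for `mGs` whenever both are (Q-fin) families of the same partners `tGs`.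

## References
* [Rogawski1990] J. D. Rogawski, *Automorphic Representations of Unitary Groups in Three Variables*, Ann. of Math. Stud. 123 (1990), §4.1 (4.1.1) p. 39; §4.3 (4.3.1) pp. 43–44;
  §5.4 p. 72; §8.2 Prop. 8.2.1 (a), (b) pp. 117–118.
* [DeitmarEchterhoff2014] A. Deitmar, S. Echterhoff, *Principles of Harmonic Analysis*, 2nd ed. (2014), Thm. 1.5.3.
-/

set_option autoImplicit false

noncomputable section

open MeasureTheory Measure NumberField IsDedekindDomain
open Literature.MeasureTheory.Group Literature.MeasureTheory.RestrictedProduct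
open Literature.Topology.RestrictedProduct Literature.Topology.Algebra.RestrictedProduct
open scoped Matrix MatrixGroups RestrictedProduct


namespace Literature.NumberTheory.Rogawski1990

open Literature.NumberTheory.Automorphic
open Literature.AlgebraicGeometry.ShimuraVarieties (unitaryGroup hermForm)

section GenericStable

variable {G : Type*} [Group G] [TopologicalSpace G] [IsTopologicalGroup G] [LocallyCompactSpace G] [SecondCountableTopology G]
  [T2Space G] [MeasurableSpace G] [BorelSpace G]
  [∀ γ : G, MeasurableSpace (G ⧸ Subgroup.centralizer ({γ} : Set G))]
  [∀ γ : G, BorelSpace (G ⧸ Subgroup.centralizer ({γ} : Set G))]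

/-- **Two Weil families of `(P, ν, t)` have the same stable class sums at every `γ` whose stable class is guarded** (`st γ x → P x`).
[cite: Rogawski1990, §4.1 (4.1.1) p. 39; §4.3 (4.3.1) p. 43] [cite: DeitmarEchterhoff2014, Thm. 1.5.3] -/
theorem stableOrbitalIntegralRel_eq_of_isQuotientOf {P : G → Prop} {ν : Measure G} [IsFiniteMeasureOnCompacts ν] [ν.IsMulRightInvariant]
    {t : ∀ γ : G, Measure (Subgroup.centralizer ({γ} : Set G))} {m₁ m₂ : OrbitalMeasureFamily G}
    (h₁ : m₁.IsQuotientOf P ν t) (h₂ : m₂.IsQuotientOf P ν t) (st : G → G → Prop) (f : G → ℂ) (γ : G) (hst : ∀ x, st γ x → P x) :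
    stableOrbitalIntegralRel st m₁ f γ = stableOrbitalIntegralRel st m₂ f γ :=
  stableOrbitalIntegralRel_congr_measure st (fun c hc => h₁.apply_eq_of_isQuotientOf h₂ c (hst _ hc)) f

end GenericStable

/-! ## The κ-block transport at the letter's frame (organ O6 VERBATIM) -/

/-- The κ-block's eigenvalue binder makes `γ₀` NON-REGULAR (`(X − e₁)²(X − e₂)` is not separable) — a two-line copy of ★
`TamagawaSingularKappaBlockTransport.not_isRegularElt_of_charpoly_eq_sq_mul` (sibling leaf, not imported). [cite: Rogawski1990, §3.1 p. 19] -/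
private theorem not_isRegularElt_of_charpoly_eq_sq_mul_aux {R : Type*} [Field R] (g : GL (Fin 3) R) (e₁ e₂ : R)
    (hchar : (g : Matrix (Fin 3) (Fin 3) R).charpoly = (Polynomial.X - Polynomial.C e₁) ^ 2 * (Polynomial.X - Polynomial.C e₂)) :
    ¬ IsRegularElt g := by
  intro hreg
  rw [isRegularElt_iff, hchar] at hreg
  have h2 := (Polynomial.Separable.of_pow (Polynomial.not_isUnit_X_sub_C e₁) two_ne_zero hreg.of_mul_left).2
  exact absurd h2 (by norm_num)

section Frame

variable (L : Type) [Field L] [NumberField L] [IsCMField L]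

variable (H' : Matrix (Fin 3) (Fin 3) L) (Tinf : ArchTransferFactor L H')
    -- σ-algebras of the `G′` side (★ (O10-c5) block), of `H_v`, `G_∞`, `H_∞`, and the Haar data — EXACTLY ★ `SingularEllipticTransfer`'s binders
    [∀ g : (UnitaryGroup.cmDatum L 3 H').Adelic, MeasurableSpace ((UnitaryGroup.cmDatum L 3 H').Adelic ⧸ Subgroup.centralizer ({g} : Set (UnitaryGroup.cmDatum L 3 H').Adelic))]
    [∀ g : (UnitaryGroup.cmDatum L 3 H').Adelic, BorelSpace ((UnitaryGroup.cmDatum L 3 H').Adelic ⧸ Subgroup.centralizer ({g} : Set (UnitaryGroup.cmDatum L 3 H').Adelic))]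
    [∀ γ : UnitaryGroup.arch (↥(maximalRealSubfield L)) L (IsCMField.complexConj L) 3 H',
      MeasurableSpace (UnitaryGroup.arch (↥(maximalRealSubfield L)) L (IsCMField.complexConj L) 3 H' ⧸ Subgroup.centralizer ({γ} : Set (UnitaryGroup.arch (↥(maximalRealSubfield L)) L (IsCMField.complexConj L) 3 H')))]
    [∀ γ : UnitaryGroup.arch (↥(maximalRealSubfield L)) L (IsCMField.complexConj L) 3 H',
      BorelSpace (UnitaryGroup.arch (↥(maximalRealSubfield L)) L (IsCMField.complexConj L) 3 H' ⧸ Subgroup.centralizer ({γ} : Set (UnitaryGroup.arch (↥(maximalRealSubfield L)) L (IsCMField.complexConj L) 3 H')))]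
    [∀ (v : HeightOneSpectrum (𝓞 ↥(maximalRealSubfield L))) (γ : (UnitaryGroup.cmDatum L 3 H').Local v),
      MeasurableSpace ((UnitaryGroup.cmDatum L 3 H').Local v ⧸ Subgroup.centralizer ({γ} : Set ((UnitaryGroup.cmDatum L 3 H').Local v)))]
    [∀ (v : HeightOneSpectrum (𝓞 ↥(maximalRealSubfield L))) (γ : (UnitaryGroup.cmDatum L 3 H').Local v),
      BorelSpace ((UnitaryGroup.cmDatum L 3 H').Local v ⧸ Subgroup.centralizer ({γ} : Set ((UnitaryGroup.cmDatum L 3 H').Local v)))]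
    [∀ v : HeightOneSpectrum (𝓞 ↥(maximalRealSubfield L)), MeasurableSpace ((UnitaryGroup.cmDatum L 3 H').Local v)] [∀ v : HeightOneSpectrum (𝓞 ↥(maximalRealSubfield L)), BorelSpace ((UnitaryGroup.cmDatum L 3 H').Local v)]
    [MeasurableSpace (UnitaryGroup.cmDatum L 3 H').Adelic] [BorelSpace (UnitaryGroup.cmDatum L 3 H').Adelic]
    [MeasurableSpace (UnitaryGroup.arch (↥(maximalRealSubfield L)) L (IsCMField.complexConj L) 3 H')] [BorelSpace (UnitaryGroup.arch (↥(maximalRealSubfield L)) L (IsCMField.complexConj L) 3 H')]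
    [∀ γ : (UnitaryGroup.cmDatum L 3 H').Adelic, MeasurableSpace (↥(Subgroup.centralizer ({γ} : Set (UnitaryGroup.cmDatum L 3 H').Adelic)) ⧸
      ((UnitaryGroup.cmDatum L 3 H').quotientSubgroup ⊓ Subgroup.centralizer ({γ} : Set (UnitaryGroup.cmDatum L 3 H').Adelic)).subgroupOf (Subgroup.centralizer ({γ} : Set (UnitaryGroup.cmDatum L 3 H').Adelic)))]
    [∀ γ : (UnitaryGroup.cmDatum L 3 H').Adelic, BorelSpace (↥(Subgroup.centralizer ({γ} : Set (UnitaryGroup.cmDatum L 3 H').Adelic)) ⧸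
      ((UnitaryGroup.cmDatum L 3 H').quotientSubgroup ⊓ Subgroup.centralizer ({γ} : Set (UnitaryGroup.cmDatum L 3 H').Adelic)).subgroupOf (Subgroup.centralizer ({γ} : Set (UnitaryGroup.cmDatum L 3 H').Adelic)))]
    [hCcl : ∀ γ : (UnitaryGroup.cmDatum L 3 H').Adelic, IsClosed ((Subgroup.centralizer ({γ} : Set (UnitaryGroup.cmDatum L 3 H').Adelic) : Subgroup (UnitaryGroup.cmDatum L 3 H').Adelic) : Set (UnitaryGroup.cmDatum L 3 H').Adelic)]
    [∀ γ : (UnitaryGroup.cmDatum L 3 H').Adelic, (count : Measure ↥(((UnitaryGroup.cmDatum L 3 H').quotientSubgroup ⊓ Subgroup.centralizer ({γ} : Set (UnitaryGroup.cmDatum L 3 H').Adelic)).subgroupOf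
      (Subgroup.centralizer ({γ} : Set (UnitaryGroup.cmDatum L 3 H').Adelic)))).IsHaarMeasure]
    [∀ v : HeightOneSpectrum (𝓞 ↥(maximalRealSubfield L)), MeasurableSpace ((UnitaryGroup.cmDatum L 2 (Matrix.of fun i j : Fin 2 => if i.val + j.val + 1 = 2 then (1 : L) else 0)).Local v ×
        (UnitaryGroup.cmDatum L 1 (Matrix.of fun i j : Fin 1 => if i.val + j.val + 1 = 1 then (1 : L) else 0)).Local v)]
    [∀ v : HeightOneSpectrum (𝓞 ↥(maximalRealSubfield L)), BorelSpace ((UnitaryGroup.cmDatum L 2 (Matrix.of fun i j : Fin 2 => if i.val + j.val + 1 = 2 then (1 : L) else 0)).Local v ×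
        (UnitaryGroup.cmDatum L 1 (Matrix.of fun i j : Fin 1 => if i.val + j.val + 1 = 1 then (1 : L) else 0)).Local v)]
    [∀ (v : HeightOneSpectrum (𝓞 ↥(maximalRealSubfield L))) (a : ((UnitaryGroup.cmDatum L 2 (Matrix.of fun i j : Fin 2 => if i.val + j.val + 1 = 2 then (1 : L) else 0)).Local v ×
        (UnitaryGroup.cmDatum L 1 (Matrix.of fun i j : Fin 1 => if i.val + j.val + 1 = 1 then (1 : L) else 0)).Local v)),
      MeasurableSpace (((UnitaryGroup.cmDatum L 2 (Matrix.of fun i j : Fin 2 => if i.val + j.val + 1 = 2 then (1 : L) else 0)).Local v ×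
        (UnitaryGroup.cmDatum L 1 (Matrix.of fun i j : Fin 1 => if i.val + j.val + 1 = 1 then (1 : L) else 0)).Local v) ⧸ Subgroup.centralizer ({a} : Set ((UnitaryGroup.cmDatum L 2 (Matrix.of fun i j : Fin 2 => if i.val + j.val + 1 = 2 then (1 : L) else 0)).Local v ×
        (UnitaryGroup.cmDatum L 1 (Matrix.of fun i j : Fin 1 => if i.val + j.val + 1 = 1 then (1 : L) else 0)).Local v)))]
    [∀ (v : HeightOneSpectrum (𝓞 ↥(maximalRealSubfield L))) (a : ((UnitaryGroup.cmDatum L 2 (Matrix.of fun i j : Fin 2 => if i.val + j.val + 1 = 2 then (1 : L) else 0)).Local v ×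
        (UnitaryGroup.cmDatum L 1 (Matrix.of fun i j : Fin 1 => if i.val + j.val + 1 = 1 then (1 : L) else 0)).Local v)),
      BorelSpace (((UnitaryGroup.cmDatum L 2 (Matrix.of fun i j : Fin 2 => if i.val + j.val + 1 = 2 then (1 : L) else 0)).Local v ×
        (UnitaryGroup.cmDatum L 1 (Matrix.of fun i j : Fin 1 => if i.val + j.val + 1 = 1 then (1 : L) else 0)).Local v) ⧸ Subgroup.centralizer ({a} : Set ((UnitaryGroup.cmDatum L 2 (Matrix.of fun i j : Fin 2 => if i.val + j.val + 1 = 2 then (1 : L) else 0)).Local v ×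
        (UnitaryGroup.cmDatum L 1 (Matrix.of fun i j : Fin 1 => if i.val + j.val + 1 = 1 then (1 : L) else 0)).Local v)))]
    [MeasurableSpace (UnitaryGroup.arch (↥(maximalRealSubfield L)) L (IsCMField.complexConj L) 3 (Matrix.of fun i j : Fin 3 => if i.val + j.val + 1 = 3 then (1 : L) else 0))] [BorelSpace (UnitaryGroup.arch (↥(maximalRealSubfield L)) L (IsCMField.complexConj L) 3 (Matrix.of fun i j : Fin 3 => if i.val + j.val + 1 = 3 then (1 : L) else 0))]
    [∀ γ : UnitaryGroup.arch (↥(maximalRealSubfield L)) L (IsCMField.complexConj L) 3 (Matrix.of fun i j : Fin 3 => if i.val + j.val + 1 = 3 then (1 : L) else 0),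
      MeasurableSpace (UnitaryGroup.arch (↥(maximalRealSubfield L)) L (IsCMField.complexConj L) 3 (Matrix.of fun i j : Fin 3 => if i.val + j.val + 1 = 3 then (1 : L) else 0) ⧸ Subgroup.centralizer ({γ} : Set (UnitaryGroup.arch (↥(maximalRealSubfield L)) L (IsCMField.complexConj L) 3 (Matrix.of fun i j : Fin 3 => if i.val + j.val + 1 = 3 then (1 : L) else 0))))]
    [∀ γ : UnitaryGroup.arch (↥(maximalRealSubfield L)) L (IsCMField.complexConj L) 3 (Matrix.of fun i j : Fin 3 => if i.val + j.val + 1 = 3 then (1 : L) else 0),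
      BorelSpace (UnitaryGroup.arch (↥(maximalRealSubfield L)) L (IsCMField.complexConj L) 3 (Matrix.of fun i j : Fin 3 => if i.val + j.val + 1 = 3 then (1 : L) else 0) ⧸ Subgroup.centralizer ({γ} : Set (UnitaryGroup.arch (↥(maximalRealSubfield L)) L (IsCMField.complexConj L) 3 (Matrix.of fun i j : Fin 3 => if i.val + j.val + 1 = 3 then (1 : L) else 0))))]
    [MeasurableSpace (UnitaryGroup.arch (↥(maximalRealSubfield L)) L (IsCMField.complexConj L) 2 (Matrix.of fun i j : Fin 2 => if i.val + j.val + 1 = 2 then (1 : L) else 0) ×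
          UnitaryGroup.arch (↥(maximalRealSubfield L)) L (IsCMField.complexConj L) 1 (Matrix.of fun i j : Fin 1 => if i.val + j.val + 1 = 1 then (1 : L) else 0))]
    [BorelSpace (UnitaryGroup.arch (↥(maximalRealSubfield L)) L (IsCMField.complexConj L) 2 (Matrix.of fun i j : Fin 2 => if i.val + j.val + 1 = 2 then (1 : L) else 0) ×
          UnitaryGroup.arch (↥(maximalRealSubfield L)) L (IsCMField.complexConj L) 1 (Matrix.of fun i j : Fin 1 => if i.val + j.val + 1 = 1 then (1 : L) else 0))]
    [∀ a : (UnitaryGroup.arch (↥(maximalRealSubfield L)) L (IsCMField.complexConj L) 2 (Matrix.of fun i j : Fin 2 => if i.val + j.val + 1 = 2 then (1 : L) else 0) ×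
          UnitaryGroup.arch (↥(maximalRealSubfield L)) L (IsCMField.complexConj L) 1 (Matrix.of fun i j : Fin 1 => if i.val + j.val + 1 = 1 then (1 : L) else 0)),
      MeasurableSpace ((UnitaryGroup.arch (↥(maximalRealSubfield L)) L (IsCMField.complexConj L) 2 (Matrix.of fun i j : Fin 2 => if i.val + j.val + 1 = 2 then (1 : L) else 0) ×
          UnitaryGroup.arch (↥(maximalRealSubfield L)) L (IsCMField.complexConj L) 1 (Matrix.of fun i j : Fin 1 => if i.val + j.val + 1 = 1 then (1 : L) else 0)) ⧸ Subgroup.centralizer ({a} : Set (UnitaryGroup.arch (↥(maximalRealSubfield L)) L (IsCMField.complexConj L) 2 (Matrix.of fun i j : Fin 2 => if i.val + j.val + 1 = 2 then (1 : L) else 0) ×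
          UnitaryGroup.arch (↥(maximalRealSubfield L)) L (IsCMField.complexConj L) 1 (Matrix.of fun i j : Fin 1 => if i.val + j.val + 1 = 1 then (1 : L) else 0))))]
    [∀ a : (UnitaryGroup.arch (↥(maximalRealSubfield L)) L (IsCMField.complexConj L) 2 (Matrix.of fun i j : Fin 2 => if i.val + j.val + 1 = 2 then (1 : L) else 0) ×
          UnitaryGroup.arch (↥(maximalRealSubfield L)) L (IsCMField.complexConj L) 1 (Matrix.of fun i j : Fin 1 => if i.val + j.val + 1 = 1 then (1 : L) else 0)),
      BorelSpace ((UnitaryGroup.arch (↥(maximalRealSubfield L)) L (IsCMField.complexConj L) 2 (Matrix.of fun i j : Fin 2 => if i.val + j.val + 1 = 2 then (1 : L) else 0) ×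
          UnitaryGroup.arch (↥(maximalRealSubfield L)) L (IsCMField.complexConj L) 1 (Matrix.of fun i j : Fin 1 => if i.val + j.val + 1 = 1 then (1 : L) else 0)) ⧸ Subgroup.centralizer ({a} : Set (UnitaryGroup.arch (↥(maximalRealSubfield L)) L (IsCMField.complexConj L) 2 (Matrix.of fun i j : Fin 2 => if i.val + j.val + 1 = 2 then (1 : L) else 0) ×
          UnitaryGroup.arch (↥(maximalRealSubfield L)) L (IsCMField.complexConj L) 1 (Matrix.of fun i j : Fin 1 => if i.val + j.val + 1 = 1 then (1 : L) else 0))))]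
    (νH : ∀ v : HeightOneSpectrum (𝓞 ↥(maximalRealSubfield L)), Measure ((UnitaryGroup.cmDatum L 2 (Matrix.of fun i j : Fin 2 => if i.val + j.val + 1 = 2 then (1 : L) else 0)).Local v ×
        (UnitaryGroup.cmDatum L 1 (Matrix.of fun i j : Fin 1 => if i.val + j.val + 1 = 1 then (1 : L) else 0)).Local v))
    (νG : ∀ v : HeightOneSpectrum (𝓞 ↥(maximalRealSubfield L)), Measure ((UnitaryGroup.cmDatum L 3 H').Local v))
    [∀ v, IsFiniteMeasureOnCompacts (νH v)] [∀ v, (νH v).IsMulRightInvariant]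
    [∀ v, (νG v).IsHaarMeasure] [∀ v, (νG v).IsMulRightInvariant]  -- MAIN-b's strength (F2): `νG_v` Haar
    (νGi : Measure (UnitaryGroup.arch (↥(maximalRealSubfield L)) L (IsCMField.complexConj L) 3 H')) (νqi : Measure (UnitaryGroup.arch (↥(maximalRealSubfield L)) L (IsCMField.complexConj L) 3 (Matrix.of fun i j : Fin 3 => if i.val + j.val + 1 = 3 then (1 : L) else 0)))
    (νHi : Measure (UnitaryGroup.arch (↥(maximalRealSubfield L)) L (IsCMField.complexConj L) 2 (Matrix.of fun i j : Fin 2 => if i.val + j.val + 1 = 2 then (1 : L) else 0) ×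
          UnitaryGroup.arch (↥(maximalRealSubfield L)) L (IsCMField.complexConj L) 1 (Matrix.of fun i j : Fin 1 => if i.val + j.val + 1 = 1 then (1 : L) else 0)))
    [IsFiniteMeasureOnCompacts νGi] [νGi.IsMulRightInvariant] [IsFiniteMeasureOnCompacts νqi] [νqi.IsMulRightInvariant]
    [IsFiniteMeasureOnCompacts νHi] [νHi.IsMulRightInvariant]

omit [∀ g : (UnitaryGroup.cmDatum L 3 H').Adelic, MeasurableSpace ((UnitaryGroup.cmDatum L 3 H').Adelic ⧸ Subgroup.centralizer ({g} : Set (UnitaryGroup.cmDatum L 3 H').Adelic))]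
  [∀ g : (UnitaryGroup.cmDatum L 3 H').Adelic, BorelSpace ((UnitaryGroup.cmDatum L 3 H').Adelic ⧸ Subgroup.centralizer ({g} : Set (UnitaryGroup.cmDatum L 3 H').Adelic))]
  [MeasurableSpace (UnitaryGroup.cmDatum L 3 H').Adelic] [BorelSpace (UnitaryGroup.cmDatum L 3 H').Adelic]
  [∀ γ : (UnitaryGroup.cmDatum L 3 H').Adelic, MeasurableSpace (↥(Subgroup.centralizer ({γ} : Set (UnitaryGroup.cmDatum L 3 H').Adelic)) ⧸
      ((UnitaryGroup.cmDatum L 3 H').quotientSubgroup ⊓ Subgroup.centralizer ({γ} : Set (UnitaryGroup.cmDatum L 3 H').Adelic)).subgroupOf (Subgroup.centralizer ({γ} : Set (UnitaryGroup.cmDatum L 3 H').Adelic)))]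
  [∀ γ : (UnitaryGroup.cmDatum L 3 H').Adelic, BorelSpace (↥(Subgroup.centralizer ({γ} : Set (UnitaryGroup.cmDatum L 3 H').Adelic)) ⧸
      ((UnitaryGroup.cmDatum L 3 H').quotientSubgroup ⊓ Subgroup.centralizer ({γ} : Set (UnitaryGroup.cmDatum L 3 H').Adelic)).subgroupOf (Subgroup.centralizer ({γ} : Set (UnitaryGroup.cmDatum L 3 H').Adelic)))]
  hCcl
  [∀ γ : (UnitaryGroup.cmDatum L 3 H').Adelic, (count : Measure ↥(((UnitaryGroup.cmDatum L 3 H').quotientSubgroup ⊓ Subgroup.centralizer ({γ} : Set (UnitaryGroup.cmDatum L 3 H').Adelic)).subgroupOf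
      (Subgroup.centralizer ({γ} : Set (UnitaryGroup.cmDatum L 3 H').Adelic)))).IsHaarMeasure] in
set_option maxHeartbeats 16000000 in
set_option synthInstance.maxHeartbeats 800000 in
-- HB: statement elaboration of the organ's frame prefix (`hCTM`, `hACS`) on the concrete carriers — the letter's own budget (★ p844690)
/-- **ORGAN O6 «κ-TRANSPORT» (LH5 skeleton v1 `stub_kappaBlock_transport`, VERBATIM).**  At the letter's frame (binders `hK hanis Sbad Δ mH mG m′ m mHi t′ t tH hherm hCTM hACS`, then
partners `tGs` and TWO finite families `mGs₀`, `mGs`): if both are (Q-fin) Weil families of `νG_v` by `tGs v` on the singular guard, the κ-BLOCK-TF of ★ `TamagawaSingularMembersFinTFCovol`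
((κ-loc) ∧ (κ-arch) ∧ (κ-sign), token for token) passes from `mGs₀` to `mGs` with the SAME constants: (κ-loc) reads the members only through `localStableOrbitalIntegral … (mGs v) f (γ₀)_v`, a
sum over classes stably conjugate to `(γ₀)_v`, all guarded by the non-regular `γ₀` itself (★ `corresponds_self_iff`), where the two families coincide
(`IsQuotientOf.apply_eq_of_isQuotientOf`); (κ-arch), (κ-sign) do not read them. [cite: Rogawski1990, §4.1 (4.1.1) p. 39; §4.3 (4.3.1) pp. 43–44; §5.4 p. 72; §8.2 Prop. 8.2.1 (a), (b) pp. 117–118]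
[cite: DeitmarEchterhoff2014, Thm. 1.5.3] -/
theorem kappaBlockTF_of_isQuotientOf_of_isQuotientOf :
    ∀ (hK : ∀ v : HeightOneSpectrum (𝓞 ↥(maximalRealSubfield L)), νG v (UnitaryGroup.cmLocalIntegralLevel L 3 H' v : Set ((UnitaryGroup.cmDatum L 3 H').Local v)) = 1)
  (hanis : ∀ x : Fin 3 → L, hermForm (cmConjRingHom L) H' x x = 0 → x = 0)
  (Sbad : Finset (HeightOneSpectrum (𝓞 ↥(maximalRealSubfield L))))
      (Δ : ∀ v : HeightOneSpectrum (𝓞 ↥(maximalRealSubfield L)), LocalTransferFactor L H' v)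
      (mH : ∀ v : HeightOneSpectrum (𝓞 ↥(maximalRealSubfield L)),
        OrbitalMeasureFamily ((UnitaryGroup.cmDatum L 2 (Matrix.of fun i j : Fin 2 => if i.val + j.val + 1 = 2 then (1 : L) else 0)).Local v ×
          (UnitaryGroup.cmDatum L 1 (Matrix.of fun i j : Fin 1 => if i.val + j.val + 1 = 1 then (1 : L) else 0)).Local v))
      (mG : ∀ v : HeightOneSpectrum (𝓞 ↥(maximalRealSubfield L)), OrbitalMeasureFamily ((UnitaryGroup.cmDatum L 3 H').Local v))
  (m' : OrbitalMeasureFamily (UnitaryGroup.arch (↥(maximalRealSubfield L)) L (IsCMField.complexConj L) 3 H'))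
        (m : OrbitalMeasureFamily (UnitaryGroup.arch (↥(maximalRealSubfield L)) L (IsCMField.complexConj L) 3
          (Matrix.of fun i j : Fin 3 => if i.val + j.val + 1 = 3 then (1 : L) else 0)))
        (mHi : OrbitalMeasureFamily (UnitaryGroup.arch (↥(maximalRealSubfield L)) L (IsCMField.complexConj L) 2
            (Matrix.of fun i j : Fin 2 => if i.val + j.val + 1 = 2 then (1 : L) else 0) ×
          UnitaryGroup.arch (↥(maximalRealSubfield L)) L (IsCMField.complexConj L) 1
            (Matrix.of fun i j : Fin 1 => if i.val + j.val + 1 = 1 then (1 : L) else 0)))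
        (t' : ∀ γ' : UnitaryGroup.arch (↥(maximalRealSubfield L)) L (IsCMField.complexConj L) 3 H',
          Measure (Subgroup.centralizer ({γ'} : Set (UnitaryGroup.arch (↥(maximalRealSubfield L)) L (IsCMField.complexConj L) 3 H'))))
        (t : ∀ γ : UnitaryGroup.arch (↥(maximalRealSubfield L)) L (IsCMField.complexConj L) 3
            (Matrix.of fun i j : Fin 3 => if i.val + j.val + 1 = 3 then (1 : L) else 0),
          Measure (Subgroup.centralizer ({γ} : Set (UnitaryGroup.arch (↥(maximalRealSubfield L)) L (IsCMField.complexConj L) 3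
            (Matrix.of fun i j : Fin 3 => if i.val + j.val + 1 = 3 then (1 : L) else 0)))))
        (tH : ∀ γH : UnitaryGroup.arch (↥(maximalRealSubfield L)) L (IsCMField.complexConj L) 2
              (Matrix.of fun i j : Fin 2 => if i.val + j.val + 1 = 2 then (1 : L) else 0) ×
            UnitaryGroup.arch (↥(maximalRealSubfield L)) L (IsCMField.complexConj L) 1
              (Matrix.of fun i j : Fin 1 => if i.val + j.val + 1 = 1 then (1 : L) else 0),
          Measure (Subgroup.centralizer ({γH} : Set (UnitaryGroup.arch (↥(maximalRealSubfield L)) L (IsCMField.complexConj L) 2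
              (Matrix.of fun i j : Fin 2 => if i.val + j.val + 1 = 2 then (1 : L) else 0) ×
            UnitaryGroup.arch (↥(maximalRealSubfield L)) L (IsCMField.complexConj L) 1
              (Matrix.of fun i j : Fin 1 => if i.val + j.val + 1 = 1 then (1 : L) else 0)))))
    (hherm : (H'.map (cmConjRingHom L)).transpose = H')
    (hCTM : CanonicalTransferMatrix L H' Tinf.Δ νH νG Sbad Δ mH mG)
    (hACS : ArchCanonicalSingularMatrix L H' Tinf νGi νqi νHi hanis m' m mHi t' t tH),
    ∀ (tGs : ∀ (v : HeightOneSpectrum (𝓞 ↥(maximalRealSubfield L))) (γ : (UnitaryGroup.cmDatum L 3 H').Local v), Measure ↥(Subgroup.centralizer ({γ} : Set ((UnitaryGroup.cmDatum L 3 H').Local v))))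
      (mGs₀ : ∀ v : HeightOneSpectrum (𝓞 ↥(maximalRealSubfield L)), OrbitalMeasureFamily ((UnitaryGroup.cmDatum L 3 H').Local v))
      (mGs : ∀ v : HeightOneSpectrum (𝓞 ↥(maximalRealSubfield L)), OrbitalMeasureFamily ((UnitaryGroup.cmDatum L 3 H').Local v)),
      -- (Q-fin) for `mGs₀` and for `mGs` (same partners `tGs`)
      (∀ v, (mGs₀ v).IsQuotientOf (fun x : (UnitaryGroup.cmDatum L 3 H').Local v => ∃ γ₀ : (UnitaryGroup.cmDatum L 3 H').Rational, ¬ IsRegularElt (γ₀.val : GL (Fin 3) L) ∧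
            Corresponds (UnitaryGroup.conjLocal L (IsCMField.complexConj L) v)
              ((UnitaryGroup.adelicForm L 3 H').map (UnitaryGroup.adeleToLocal L v))
              ((UnitaryGroup.adelicForm L 3 H').map (UnitaryGroup.adeleToLocal L v))
              ((UnitaryGroup.cmDatum L 3 H').toLocal v ((UnitaryGroup.cmDatum L 3 H').toAdelic γ₀)) x) (νG v) (tGs v)) →
      (∀ v, (mGs v).IsQuotientOf (fun x : (UnitaryGroup.cmDatum L 3 H').Local v => ∃ γ₀ : (UnitaryGroup.cmDatum L 3 H').Rational, ¬ IsRegularElt (γ₀.val : GL (Fin 3) L) ∧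
            Corresponds (UnitaryGroup.conjLocal L (IsCMField.complexConj L) v)
              ((UnitaryGroup.adelicForm L 3 H').map (UnitaryGroup.adeleToLocal L v))
              ((UnitaryGroup.adelicForm L 3 H').map (UnitaryGroup.adeleToLocal L v))
              ((UnitaryGroup.cmDatum L 3 H').toLocal v ((UnitaryGroup.cmDatum L 3 H').toAdelic γ₀)) x) (νG v) (tGs v)) →
      -- κ-BLOCK-TF VERBATIM for `mGs₀` ⟹ κ-BLOCK-TF VERBATIM for `mGs`
      (∀ (γ₀ : (UnitaryGroup.cmDatum L 3 H').Rational) (e₁ e₂ : L), e₁ ≠ e₂ →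
        ((((γ₀ : unitaryGroup (cmConjRingHom L) H').val : GL (Fin 3) L) : Matrix (Fin 3) (Fin 3) L) - e₁ • (1 : Matrix (Fin 3) (Fin 3) L)) * ((((γ₀ : unitaryGroup (cmConjRingHom L) H').val : GL (Fin 3) L) : Matrix (Fin 3) (Fin 3) L) - e₂ • (1 : Matrix (Fin 3) (Fin 3) L)) = 0 →
        (¬ ∃ ζ : L, (((γ₀ : unitaryGroup (cmConjRingHom L) H').val : GL (Fin 3) L) : Matrix (Fin 3) (Fin 3) L) = ζ • (1 : Matrix (Fin 3) (Fin 3) L)) →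
        (((γ₀ : unitaryGroup (cmConjRingHom L) H').val : GL (Fin 3) L) : Matrix (Fin 3) (Fin 3) L).charpoly =
          (Polynomial.X - Polynomial.C e₁) ^ 2 * (Polynomial.X - Polynomial.C e₂) →
        ∀ (γH : (UnitaryGroup.cmDatum L 2 (Matrix.of fun i j : Fin 2 => if i.val + j.val + 1 = 2 then (1 : L) else 0)).Rational ×
            (UnitaryGroup.cmDatum L 1 (Matrix.of fun i j : Fin 1 => if i.val + j.val + 1 = 1 then (1 : L) else 0)).Rational),
          (((γH.1 : unitaryGroup (cmConjRingHom L) (Matrix.of fun i j : Fin 2 => if i.val + j.val + 1 = 2 then (1 : L) else 0)).val : GL (Fin 2) L) : Matrix (Fin 2) (Fin 2) L) =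
            e₁ • (1 : Matrix (Fin 2) (Fin 2) L) →
          (((γH.2 : unitaryGroup (cmConjRingHom L) (Matrix.of fun i j : Fin 1 => if i.val + j.val + 1 = 1 then (1 : L) else 0)).val : GL (Fin 1) L) : Matrix (Fin 1) (Fin 1) L) 0 0 = e₂ →
          ∃ (c : HeightOneSpectrum (𝓞 ↥(maximalRealSubfield L)) → ℂ) (cinf : ℂ), (∀ v, c v ≠ 0) ∧ cinf ≠ 0 ∧
            (∀ (v : HeightOneSpectrum (𝓞 ↥(maximalRealSubfield L)))
                  (fH : (UnitaryGroup.cmDatum L 2 (Matrix.of fun i j : Fin 2 => if i.val + j.val + 1 = 2 then (1 : L) else 0)).Local v × (UnitaryGroup.cmDatum L 1 (Matrix.of fun i j : Fin 1 => if i.val + j.val + 1 = 1 then (1 : L) else 0)).Local v → ℂ) (f : (UnitaryGroup.cmDatum L 3 H').Local v → ℂ),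
                IsLocSmooth f → IsLocSmooth fH → IsLocalDeltaTransfer L H' v (Δ v) (mH v) (mG v) fH f →
                localStableOrbitalIntegral L 3 H' v (mGs₀ v) f ((UnitaryGroup.cmDatum L 3 H').toLocal v ((UnitaryGroup.cmDatum L 3 H').toAdelic γ₀)) =
                  c v * fH ((UnitaryGroup.cmDatum L 2 (Matrix.of fun i j : Fin 2 => if i.val + j.val + 1 = 2 then (1 : L) else 0)).toLocal v ((UnitaryGroup.cmDatum L 2 (Matrix.of fun i j : Fin 2 => if i.val + j.val + 1 = 2 then (1 : L) else 0)).toAdelic γH.1),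
                    (UnitaryGroup.cmDatum L 1 (Matrix.of fun i j : Fin 1 => if i.val + j.val + 1 = 1 then (1 : L) else 0)).toLocal v ((UnitaryGroup.cmDatum L 1 (Matrix.of fun i j : Fin 1 => if i.val + j.val + 1 = 1 then (1 : L) else 0)).toAdelic γH.2))) ∧
            (∀ (aH : UnitaryGroup.arch (↥(maximalRealSubfield L)) L (IsCMField.complexConj L) 2 (Matrix.of fun i j : Fin 2 => if i.val + j.val + 1 = 2 then (1 : L) else 0) ×
                    UnitaryGroup.arch (↥(maximalRealSubfield L)) L (IsCMField.complexConj L) 1 (Matrix.of fun i j : Fin 1 => if i.val + j.val + 1 = 1 then (1 : L) else 0) → ℂ)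
                  (a : UnitaryGroup.arch (↥(maximalRealSubfield L)) L (IsCMField.complexConj L) 3 H' → ℂ),
                ArchSmooth L 3 H' a → ArchSmooth₂ L aH → IsArchDeltaTransfer L H' Tinf mHi m' aH a →
                archStableOrbitalIntegral L 3 H' (Literature.NumberTheory.Weil1964.UnitaryArchTopForm.archSingularTopFormFamily L H' νGi) a (cmRationalToArch L 3 H' γ₀) =
                  cinf * aH (cmRationalToArch L 2 (Matrix.of fun i j : Fin 2 => if i.val + j.val + 1 = 2 then (1 : L) else 0) γH.1, cmRationalToArch L 1 (Matrix.of fun i j : Fin 1 => if i.val + j.val + 1 = 1 then (1 : L) else 0) γH.2)) ∧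
            (∀ S_c : Finset (HeightOneSpectrum (𝓞 ↥(maximalRealSubfield L))), (∀ v ∉ S_c, c v = 1) →
                ∃ r : ℝ, 0 < r ∧ cinf * ∏ v ∈ S_c, c v = (r : ℂ))) →
      (∀ (γ₀ : (UnitaryGroup.cmDatum L 3 H').Rational) (e₁ e₂ : L), e₁ ≠ e₂ →
        ((((γ₀ : unitaryGroup (cmConjRingHom L) H').val : GL (Fin 3) L) : Matrix (Fin 3) (Fin 3) L) - e₁ • (1 : Matrix (Fin 3) (Fin 3) L)) * ((((γ₀ : unitaryGroup (cmConjRingHom L) H').val : GL (Fin 3) L) : Matrix (Fin 3) (Fin 3) L) - e₂ • (1 : Matrix (Fin 3) (Fin 3) L)) = 0 →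
        (¬ ∃ ζ : L, (((γ₀ : unitaryGroup (cmConjRingHom L) H').val : GL (Fin 3) L) : Matrix (Fin 3) (Fin 3) L) = ζ • (1 : Matrix (Fin 3) (Fin 3) L)) →
        (((γ₀ : unitaryGroup (cmConjRingHom L) H').val : GL (Fin 3) L) : Matrix (Fin 3) (Fin 3) L).charpoly =
          (Polynomial.X - Polynomial.C e₁) ^ 2 * (Polynomial.X - Polynomial.C e₂) →
        ∀ (γH : (UnitaryGroup.cmDatum L 2 (Matrix.of fun i j : Fin 2 => if i.val + j.val + 1 = 2 then (1 : L) else 0)).Rational ×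
            (UnitaryGroup.cmDatum L 1 (Matrix.of fun i j : Fin 1 => if i.val + j.val + 1 = 1 then (1 : L) else 0)).Rational),
          (((γH.1 : unitaryGroup (cmConjRingHom L) (Matrix.of fun i j : Fin 2 => if i.val + j.val + 1 = 2 then (1 : L) else 0)).val : GL (Fin 2) L) : Matrix (Fin 2) (Fin 2) L) =
            e₁ • (1 : Matrix (Fin 2) (Fin 2) L) →
          (((γH.2 : unitaryGroup (cmConjRingHom L) (Matrix.of fun i j : Fin 1 => if i.val + j.val + 1 = 1 then (1 : L) else 0)).val : GL (Fin 1) L) : Matrix (Fin 1) (Fin 1) L) 0 0 = e₂ →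
          ∃ (c : HeightOneSpectrum (𝓞 ↥(maximalRealSubfield L)) → ℂ) (cinf : ℂ), (∀ v, c v ≠ 0) ∧ cinf ≠ 0 ∧
            (∀ (v : HeightOneSpectrum (𝓞 ↥(maximalRealSubfield L)))
                  (fH : (UnitaryGroup.cmDatum L 2 (Matrix.of fun i j : Fin 2 => if i.val + j.val + 1 = 2 then (1 : L) else 0)).Local v × (UnitaryGroup.cmDatum L 1 (Matrix.of fun i j : Fin 1 => if i.val + j.val + 1 = 1 then (1 : L) else 0)).Local v → ℂ) (f : (UnitaryGroup.cmDatum L 3 H').Local v → ℂ),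
                IsLocSmooth f → IsLocSmooth fH → IsLocalDeltaTransfer L H' v (Δ v) (mH v) (mG v) fH f →
                localStableOrbitalIntegral L 3 H' v (mGs v) f ((UnitaryGroup.cmDatum L 3 H').toLocal v ((UnitaryGroup.cmDatum L 3 H').toAdelic γ₀)) =
                  c v * fH ((UnitaryGroup.cmDatum L 2 (Matrix.of fun i j : Fin 2 => if i.val + j.val + 1 = 2 then (1 : L) else 0)).toLocal v ((UnitaryGroup.cmDatum L 2 (Matrix.of fun i j : Fin 2 => if i.val + j.val + 1 = 2 then (1 : L) else 0)).toAdelic γH.1),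
                    (UnitaryGroup.cmDatum L 1 (Matrix.of fun i j : Fin 1 => if i.val + j.val + 1 = 1 then (1 : L) else 0)).toLocal v ((UnitaryGroup.cmDatum L 1 (Matrix.of fun i j : Fin 1 => if i.val + j.val + 1 = 1 then (1 : L) else 0)).toAdelic γH.2))) ∧
            (∀ (aH : UnitaryGroup.arch (↥(maximalRealSubfield L)) L (IsCMField.complexConj L) 2 (Matrix.of fun i j : Fin 2 => if i.val + j.val + 1 = 2 then (1 : L) else 0) ×
                    UnitaryGroup.arch (↥(maximalRealSubfield L)) L (IsCMField.complexConj L) 1 (Matrix.of fun i j : Fin 1 => if i.val + j.val + 1 = 1 then (1 : L) else 0) → ℂ)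
                  (a : UnitaryGroup.arch (↥(maximalRealSubfield L)) L (IsCMField.complexConj L) 3 H' → ℂ),
                ArchSmooth L 3 H' a → ArchSmooth₂ L aH → IsArchDeltaTransfer L H' Tinf mHi m' aH a →
                archStableOrbitalIntegral L 3 H' (Literature.NumberTheory.Weil1964.UnitaryArchTopForm.archSingularTopFormFamily L H' νGi) a (cmRationalToArch L 3 H' γ₀) =
                  cinf * aH (cmRationalToArch L 2 (Matrix.of fun i j : Fin 2 => if i.val + j.val + 1 = 2 then (1 : L) else 0) γH.1, cmRationalToArch L 1 (Matrix.of fun i j : Fin 1 => if i.val + j.val + 1 = 1 then (1 : L) else 0) γH.2)) ∧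
            (∀ S_c : Finset (HeightOneSpectrum (𝓞 ↥(maximalRealSubfield L))), (∀ v ∉ S_c, c v = 1) →
                ∃ r : ℝ, 0 < r ∧ cinf * ∏ v ∈ S_c, c v = (r : ℂ))) := by
  intro hK hanis Sbad Δ mH mG m' m mHi t' t tH hherm hCTM hACS tGs mGs₀ mGs hQ₀ hQ hκ γ₀ e₁ e₂ hne hmul hnc hchar γH hγH1 hγH2
  obtain ⟨c, cinf, hc, hcinf, hloc, harch, hsign⟩ := hκ γ₀ e₁ e₂ hne hmul hnc hchar γH hγH1 hγH2
  refine ⟨c, cinf, hc, hcinf, fun v fH f hf hfH htr => ?_, harch, hsign⟩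
  have hreg : ¬ IsRegularElt (γ₀.val : GL (Fin 3) L) := not_isRegularElt_of_charpoly_eq_sq_mul_aux _ e₁ e₂ hchar
  have key : localStableOrbitalIntegral L 3 H' v (mGs v) f ((UnitaryGroup.cmDatum L 3 H').toLocal v ((UnitaryGroup.cmDatum L 3 H').toAdelic γ₀)) =
      localStableOrbitalIntegral L 3 H' v (mGs₀ v) f ((UnitaryGroup.cmDatum L 3 H').toLocal v ((UnitaryGroup.cmDatum L 3 H').toAdelic γ₀)) :=
    stableOrbitalIntegralRel_eq_of_isQuotientOf (hQ v) (hQ₀ v) _ f _ fun x hx => ⟨γ₀, hreg, hx⟩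
  rw [key]
  exact hloc v fH f hf hfH htr

end Frame

end Literature.NumberTheory.Rogawski1990

end
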